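import Literature.Probability.LatticeModels.TorusFourierWeightedL1
import HarnessLib

/-!
# Weighted Plancherel and `ℓ¹` bounds for character sums on a PRODUCT of tori (space-time lattice propagators)

Topic `Literature/Probability/LatticeModels`; the product-torus form of `TorusFourierWeightedL1.lean`, for character sums
`S(a, b) = Σ_{p, p'} χ_p(a) χ_{p'}(b) G(p, p')` over `(ℤ/L₁ℤ)^{d₁} × (ℤ/L₂ℤ)^{d₂}` with two different moduli — the shape in
which a finite-temperature lattice propagator on the discrete space-time torus appears (time dual torus `(ℤ/2Mℤ)¹` of the
`2M` Matsubara frequencies × momentum torus `(ℤ/Lℤ)²`; `HubbardSpaceTimeCharacters.norm_pullback_normalCovariance_le`,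
Benfatto–Giuliani–Mastropietro 2006, Lemma 2.2 and footnote ¹ at finite `(β, L)`).  Iterating the one-factor Plancherel in
each variable:

* `sum_sum_norm_sq_prodChar` — `Σ_{a,b} ‖S(a,b)‖² = L₁^{d₁} L₂^{d₂} Σ_{p,p'} ‖G(p,p')‖²`;
* **`sum_sum_weight_snd_mul_norm_sq_le`**, **`sum_sum_weight_fst_mul_norm_sq_le`** — weights `(4|ã_v(b)|/L₂)^{2N}`
  (resp. `(4|ã_u(a)|/L₁)^{2N}`) are paid by `ℓ²` norms of `N` differences of the symbol in the second (resp. first) variable;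
* **`sum_sum_norm_prodChar_le`** — `Σ_{a,b} ‖S(a,b)‖ ≤ (Σ_{a,b} W⁻¹)^{1/2} (L₁^{d₁}L₂^{d₂}[Σ‖G‖² + c₀ Σ‖Δ_u^N G‖² +
  Σ_i c_i Σ‖Δ_{v_i}^N G‖²])^{1/2}` with the additive weight `W(a,b) = 1 + c₀(4|ã_u(a)|/L₁)^{2N} + Σ_i c_i(4|ã_{v_i}(b)|/L₂)^{2N}`
  — the `L²` route to the `L¹` norm of a sector-free single-scale space-time propagator (`α_h ≲ γ^{-3h/2}` in `d = 2`).

Everything is proved; no definitions, no named facts.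

## Sources

G. Benfatto, A. Giuliani, V. Mastropietro, Ann. Henri Poincaré 7 (2006) 809–898, Lemma 2.2, (2.36aa) and footnote ¹
(`BenfattoGiulianiMastropietro2006`); S. Friedli, Y. Velenik, *Statistical Mechanics of Lattice Systems* (2017), §10.4
(`FriedliVelenik2017`).
-/

noncomputable section

open Finset Complex
open scoped Real ComplexConjugate

namespace Literature.Probability.LatticeModels

variable {d₁ L₁ d₂ L₂ : ℕ} [NeZero L₁] [NeZero L₂]

omit [NeZero L₁] [NeZero L₂] in
/-- Cauchy–Schwarz with a positive weight (local copy). [folklore] -/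
private theorem sum_norm_le_of_weight' {ι : Type*} (s : Finset ι) (g : ι → ℂ) (W : ι → ℝ) (hW : ∀ x ∈ s, 0 < W x) :
    ∑ x ∈ s, ‖g x‖ ≤ Real.sqrt (∑ x ∈ s, (W x)⁻¹) * Real.sqrt (∑ x ∈ s, W x * ‖g x‖ ^ 2) := by
  have hcs := sum_mul_sq_le_sq_mul_sq s (fun x => Real.sqrt ((W x)⁻¹)) (fun x => Real.sqrt (W x) * ‖g x‖)
  have hprod : ∀ x ∈ s, Real.sqrt ((W x)⁻¹) * (Real.sqrt (W x) * ‖g x‖) = ‖g x‖ := by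
    intro x hx
    rw [← mul_assoc, Real.sqrt_inv, inv_mul_cancel₀ (Real.sqrt_ne_zero'.2 (hW x hx)), one_mul]
  have h1 : ∀ x ∈ s, Real.sqrt ((W x)⁻¹) ^ 2 = (W x)⁻¹ := fun x hx => Real.sq_sqrt (inv_nonneg.2 (hW x hx).le)
  have h2 : ∀ x ∈ s, (Real.sqrt (W x) * ‖g x‖) ^ 2 = W x * ‖g x‖ ^ 2 := fun x hx => by
    rw [mul_pow, Real.sq_sqrt (hW x hx).le]
  rw [sum_congr rfl hprod, sum_congr rfl h1, sum_congr rfl h2] at hcs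
  have hA : 0 ≤ ∑ x ∈ s, (W x)⁻¹ := sum_nonneg fun x hx => inv_nonneg.2 (hW x hx).le
  have hS : 0 ≤ ∑ x ∈ s, ‖g x‖ := sum_nonneg fun x _ => norm_nonneg _
  rw [← Real.sqrt_mul hA, ← Real.sqrt_sq hS]
  exact Real.sqrt_le_sqrt hcs

omit [NeZero L₁] [NeZero L₂] in
/-- Fubini for the product character sum: summing first over the second momentum. [folklore] -/
private theorem prodChar_eq_snd (G : TorusSite d₁ L₁ → TorusSite d₂ L₂ → ℂ) (a : TorusSite d₁ L₁) (b : TorusSite d₂ L₂)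
    [NeZero L₁] [NeZero L₂] :
    ∑ p, ∑ p', torusChar p a * torusChar p' b * G p p' = ∑ p', torusChar p' b * ∑ p, torusChar p a * G p p' := by
  rw [sum_comm]
  refine sum_congr rfl fun p' _ => ?_
  rw [mul_sum]
  refine sum_congr rfl fun p _ => ?_
  ring

omit [NeZero L₁] [NeZero L₂] in
/-- Fubini for the product character sum: summing first over the first momentum. [folklore] -/
private theorem prodChar_eq_fst (G : TorusSite d₁ L₁ → TorusSite d₂ L₂ → ℂ) (a : TorusSite d₁ L₁) (b : TorusSite d₂ L₂)
    [NeZero L₁] [NeZero L₂] :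
    ∑ p, ∑ p', torusChar p a * torusChar p' b * G p p' = ∑ p, torusChar p a * ∑ p', torusChar p' b * G p p' := by
  refine sum_congr rfl fun p _ => ?_
  rw [mul_sum]
  refine sum_congr rfl fun p' _ => ?_
  ring

/-- **Plancherel on the product torus**: `Σ_{a,b} ‖Σ_{p,p'} χ_p(a)χ_{p'}(b) G(p,p')‖² = L₁^{d₁} L₂^{d₂} Σ_{p,p'} ‖G(p,p')‖²`
(the one-factor Plancherel in `b`, then in `a`). [cite: FriedliVelenik2017, §10.4] -/
theorem sum_sum_norm_sq_prodChar (G : TorusSite d₁ L₁ → TorusSite d₂ L₂ → ℂ) :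
    ∑ a : TorusSite d₁ L₁, ∑ b : TorusSite d₂ L₂, ‖∑ p, ∑ p', torusChar p a * torusChar p' b * G p p'‖ ^ 2 =
      (L₁ : ℝ) ^ d₁ * (L₂ : ℝ) ^ d₂ * ∑ p, ∑ p', ‖G p p'‖ ^ 2 := by
  have hb : ∀ a : TorusSite d₁ L₁, ∑ b : TorusSite d₂ L₂, ‖∑ p, ∑ p', torusChar p a * torusChar p' b * G p p'‖ ^ 2 =
      (L₂ : ℝ) ^ d₂ * ∑ p', ‖∑ p, torusChar p a * G p p'‖ ^ 2 := by
    intro a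
    simp_rw [prodChar_eq_snd G a]
    exact sum_norm_sq_sum_torusChar_mul (fun p' => ∑ p, torusChar p a * G p p')
  simp_rw [hb]
  rw [← mul_sum, sum_comm]
  have ha : ∀ p' : TorusSite d₂ L₂, ∑ a : TorusSite d₁ L₁, ‖∑ p, torusChar p a * G p p'‖ ^ 2 = (L₁ : ℝ) ^ d₁ * ∑ p, ‖G p p'‖ ^ 2 :=
    fun p' => sum_norm_sq_sum_torusChar_mul (fun p => G p p')
  simp_rw [ha]
  rw [← mul_sum, sum_comm]
  ring

/-- **Weighted Plancherel in the second factor**: with `N` differences in the direction `v ∈ (ℤ/L₂ℤ)^{d₂}`,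
`Σ_{a,b} (4|ã_v(b)|/L₂)^{2N} ‖S(a,b)‖² ≤ L₁^{d₁} L₂^{d₂} Σ_{p,p'} ‖(Δ_v^N G(p,·))(p')‖²`.
[cite: BenfattoGiulianiMastropietro2006, Lemma 2.2 and (2.36aa)] -/
theorem sum_sum_weight_snd_mul_norm_sq_le (G : TorusSite d₁ L₁ → TorusSite d₂ L₂ → ℂ) (v : TorusSite d₂ L₂) (N : ℕ) :
    ∑ a : TorusSite d₁ L₁, ∑ b : TorusSite d₂ L₂,
        (4 * |((∑ j, v j * b j).valMinAbs : ℝ)| / L₂) ^ (2 * N) * ‖∑ p, ∑ p', torusChar p a * torusChar p' b * G p p'‖ ^ 2 ≤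
      (L₁ : ℝ) ^ d₁ * (L₂ : ℝ) ^ d₂ * ∑ p, ∑ p', ‖((fwdDiff v)^[N] (G p)) p'‖ ^ 2 := by
  -- for each `a`, the one-factor weighted Plancherel applied to `K_a = Σ_p χ_p(a) • G p`
  have hK : ∀ a : TorusSite d₁ L₁, (fwdDiff v)^[N] (fun p' => ∑ p, torusChar p a * G p p') =
      fun p' => ∑ p, torusChar p a * ((fwdDiff v)^[N] (G p)) p' := by
    intro a
    have hfun : (fun p' => ∑ p, torusChar p a * G p p') = ∑ p, (torusChar p a • G p) := by
      ext p'; simp [Finset.sum_apply, smul_eq_mul]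
    rw [hfun, fwdDiff_iter_finsetSum]
    ext p'
    simp [Finset.sum_apply, fwdDiff_iter_const_smul, smul_eq_mul]
  have hb : ∀ a : TorusSite d₁ L₁, ∑ b : TorusSite d₂ L₂,
      (4 * |((∑ j, v j * b j).valMinAbs : ℝ)| / L₂) ^ (2 * N) * ‖∑ p, ∑ p', torusChar p a * torusChar p' b * G p p'‖ ^ 2 ≤
      (L₂ : ℝ) ^ d₂ * ∑ p', ‖∑ p, torusChar p a * ((fwdDiff v)^[N] (G p)) p'‖ ^ 2 := by
    intro a
    simp_rw [prodChar_eq_snd G a]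
    have h := sum_weight_mul_norm_sq_le (fun p' => ∑ p, torusChar p a * G p p') v N
    rw [hK a] at h
    exact h
  refine (sum_le_sum fun a _ => hb a).trans (le_of_eq ?_)
  rw [← mul_sum, sum_comm]
  have ha : ∀ p' : TorusSite d₂ L₂, ∑ a : TorusSite d₁ L₁, ‖∑ p, torusChar p a * ((fwdDiff v)^[N] (G p)) p'‖ ^ 2 =
      (L₁ : ℝ) ^ d₁ * ∑ p, ‖((fwdDiff v)^[N] (G p)) p'‖ ^ 2 :=
    fun p' => sum_norm_sq_sum_torusChar_mul (fun p => ((fwdDiff v)^[N] (G p)) p')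
  simp_rw [ha]
  rw [← mul_sum, sum_comm]
  ring

/-- **Weighted Plancherel in the first factor**: with `N` differences in the direction `u ∈ (ℤ/L₁ℤ)^{d₁}`,
`Σ_{a,b} (4|ã_u(a)|/L₁)^{2N} ‖S(a,b)‖² ≤ L₁^{d₁} L₂^{d₂} Σ_{p,p'} ‖(Δ_u^N G(·,p'))(p)‖²`.
[cite: BenfattoGiulianiMastropietro2006, Lemma 2.2 and (2.36aa)] -/
theorem sum_sum_weight_fst_mul_norm_sq_le (G : TorusSite d₁ L₁ → TorusSite d₂ L₂ → ℂ) (u : TorusSite d₁ L₁) (N : ℕ) :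
    ∑ a : TorusSite d₁ L₁, ∑ b : TorusSite d₂ L₂,
        (4 * |((∑ j, u j * a j).valMinAbs : ℝ)| / L₁) ^ (2 * N) * ‖∑ p, ∑ p', torusChar p a * torusChar p' b * G p p'‖ ^ 2 ≤
      (L₁ : ℝ) ^ d₁ * (L₂ : ℝ) ^ d₂ * ∑ p, ∑ p', ‖((fwdDiff u)^[N] (fun q => G q p')) p‖ ^ 2 := by
  have hK : ∀ b : TorusSite d₂ L₂, (fwdDiff u)^[N] (fun p => ∑ p', torusChar p' b * G p p') =
      fun p => ∑ p', torusChar p' b * ((fwdDiff u)^[N] (fun q => G q p')) p := by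
    intro b
    have hfun : (fun p => ∑ p', torusChar p' b * G p p') = ∑ p', (torusChar p' b • fun q => G q p') := by
      ext p; simp [Finset.sum_apply, smul_eq_mul]
    rw [hfun, fwdDiff_iter_finsetSum]
    ext p
    simp [Finset.sum_apply, fwdDiff_iter_const_smul, smul_eq_mul]
  rw [sum_comm]
  have ha : ∀ b : TorusSite d₂ L₂, ∑ a : TorusSite d₁ L₁,
      (4 * |((∑ j, u j * a j).valMinAbs : ℝ)| / L₁) ^ (2 * N) * ‖∑ p, ∑ p', torusChar p a * torusChar p' b * G p p'‖ ^ 2 ≤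
      (L₁ : ℝ) ^ d₁ * ∑ p, ‖∑ p', torusChar p' b * ((fwdDiff u)^[N] (fun q => G q p')) p‖ ^ 2 := by
    intro b
    simp_rw [prodChar_eq_fst G _ b]
    have h := sum_weight_mul_norm_sq_le (fun p => ∑ p', torusChar p' b * G p p') u N
    rw [hK b] at h
    exact h
  refine (sum_le_sum fun b _ => ha b).trans (le_of_eq ?_)
  rw [← mul_sum, sum_comm]
  have hb : ∀ p : TorusSite d₁ L₁, ∑ b : TorusSite d₂ L₂, ‖∑ p', torusChar p' b * ((fwdDiff u)^[N] (fun q => G q p')) p‖ ^ 2 =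
      (L₂ : ℝ) ^ d₂ * ∑ p', ‖((fwdDiff u)^[N] (fun q => G q p')) p‖ ^ 2 :=
    fun p => sum_norm_sq_sum_torusChar_mul (fun p' => ((fwdDiff u)^[N] (fun q => G q p')) p)
  simp_rw [hb]
  rw [← mul_sum]
  ring

/-- **The `ℓ¹` norm of a product character sum from `ℓ²` norms of symbol differences**: for a direction `u` of the first
factor with coefficient `c₀ ≥ 0`, a finite family of directions `v i` of the second factor with coefficients `c i ≥ 0`,
and `N` differences, with the additive weight `W(a,b) = 1 + c₀(4|ã_u(a)|/L₁)^{2N} + Σ_i c_i(4|ã_{v_i}(b)|/L₂)^{2N}`: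
`Σ_{a,b} ‖S(a,b)‖ ≤ (Σ_{a,b} W⁻¹)^{1/2} (L₁^{d₁}L₂^{d₂}[Σ‖G‖² + c₀ Σ‖Δ_u^N G‖² + Σ_i c_i Σ‖Δ_{v_i}^N G‖²])^{1/2}` — the
space-time `L¹` norm of a lattice propagator from `L²` data of its symbol (Benfatto–Giuliani–Mastropietro 2006, Lemma 2.2
at finite `(β, L)`, sector-free reading). [cite: BenfattoGiulianiMastropietro2006, Lemma 2.2 and footnote 1] -/
theorem sum_sum_norm_prodChar_le {ι : Type*} (T : Finset ι) (u : TorusSite d₁ L₁) (c₀ : ℝ) (hc₀ : 0 ≤ c₀)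
    (v : ι → TorusSite d₂ L₂) (c : ι → ℝ) (hc : ∀ i ∈ T, 0 ≤ c i) (N : ℕ) (G : TorusSite d₁ L₁ → TorusSite d₂ L₂ → ℂ) :
    ∑ a : TorusSite d₁ L₁, ∑ b : TorusSite d₂ L₂, ‖∑ p, ∑ p', torusChar p a * torusChar p' b * G p p'‖ ≤
      Real.sqrt (∑ a : TorusSite d₁ L₁, ∑ b : TorusSite d₂ L₂,
          (1 + c₀ * (4 * |((∑ j, u j * a j).valMinAbs : ℝ)| / L₁) ^ (2 * N) +
            ∑ i ∈ T, c i * (4 * |((∑ j, v i j * b j).valMinAbs : ℝ)| / L₂) ^ (2 * N))⁻¹) *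
        Real.sqrt ((L₁ : ℝ) ^ d₁ * (L₂ : ℝ) ^ d₂ *
          (∑ p, ∑ p', ‖G p p'‖ ^ 2 + c₀ * ∑ p, ∑ p', ‖((fwdDiff u)^[N] (fun q => G q p')) p‖ ^ 2 +
            ∑ i ∈ T, c i * ∑ p, ∑ p', ‖((fwdDiff (v i))^[N] (G p)) p'‖ ^ 2)) := by
  set W : TorusSite d₁ L₁ × TorusSite d₂ L₂ → ℝ := fun ab =>
    1 + c₀ * (4 * |((∑ j, u j * ab.1 j).valMinAbs : ℝ)| / L₁) ^ (2 * N) +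
      ∑ i ∈ T, c i * (4 * |((∑ j, v i j * ab.2 j).valMinAbs : ℝ)| / L₂) ^ (2 * N) with hW
  set S : TorusSite d₁ L₁ × TorusSite d₂ L₂ → ℂ := fun ab => ∑ p, ∑ p', torusChar p ab.1 * torusChar p' ab.2 * G p p' with hS
  have hWpos : ∀ ab ∈ (univ : Finset (TorusSite d₁ L₁ × TorusSite d₂ L₂)), 0 < W ab := fun ab _ => by
    rw [hW]
    exact add_pos_of_pos_of_nonneg (add_pos_of_pos_of_nonneg one_pos (mul_nonneg hc₀ (by positivity)))
      (sum_nonneg fun i hi => mul_nonneg (hc i hi) (by positivity))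
  have hcs := sum_norm_le_of_weight' univ S W hWpos
  rw [← univ_product_univ, sum_product, sum_product, sum_product] at hcs
  refine hcs.trans (mul_le_mul_of_nonneg_left (Real.sqrt_le_sqrt ?_) (Real.sqrt_nonneg _))
  -- `Σ W ‖S‖² ≤ L₁^{d₁}L₂^{d₂}(Σ‖G‖² + c₀ Σ‖Δ_u G‖² + Σ_i c_i Σ‖Δ_{v_i} G‖²)`
  set wu : TorusSite d₁ L₁ → ℝ := fun a => (4 * |((∑ j, u j * a j).valMinAbs : ℝ)| / L₁) ^ (2 * N) with hwu
  set wv : ι → TorusSite d₂ L₂ → ℝ := fun i b => (4 * |((∑ j, v i j * b j).valMinAbs : ℝ)| / L₂) ^ (2 * N) with hwv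
  have hpt : ∀ (a : TorusSite d₁ L₁) (b : TorusSite d₂ L₂), W (a, b) * ‖S (a, b)‖ ^ 2 =
      ‖S (a, b)‖ ^ 2 + c₀ * (wu a * ‖S (a, b)‖ ^ 2) + ∑ i ∈ T, c i * (wv i b * ‖S (a, b)‖ ^ 2) := by
    intro a b
    rw [hW, hwu, hwv]
    dsimp only
    rw [add_mul, add_mul, one_mul, sum_mul]
    congr 1
    · ring
    · exact sum_congr rfl fun i _ => by ring
  have hinner : ∀ a : TorusSite d₁ L₁, ∑ b : TorusSite d₂ L₂, W (a, b) * ‖S (a, b)‖ ^ 2 =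
      ∑ b : TorusSite d₂ L₂, ‖S (a, b)‖ ^ 2 + c₀ * ∑ b : TorusSite d₂ L₂, wu a * ‖S (a, b)‖ ^ 2 +
        ∑ i ∈ T, c i * ∑ b : TorusSite d₂ L₂, wv i b * ‖S (a, b)‖ ^ 2 := by
    intro a
    simp_rw [hpt]
    rw [sum_add_distrib, sum_add_distrib, mul_sum, sum_comm]
    simp_rw [mul_sum]
  have hsplit : ∑ a : TorusSite d₁ L₁, ∑ b : TorusSite d₂ L₂, W (a, b) * ‖S (a, b)‖ ^ 2 =
      ∑ a : TorusSite d₁ L₁, ∑ b : TorusSite d₂ L₂, ‖S (a, b)‖ ^ 2 +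
        c₀ * ∑ a : TorusSite d₁ L₁, ∑ b : TorusSite d₂ L₂, wu a * ‖S (a, b)‖ ^ 2 +
        ∑ i ∈ T, c i * ∑ a : TorusSite d₁ L₁, ∑ b : TorusSite d₂ L₂, wv i b * ‖S (a, b)‖ ^ 2 := by
    simp_rw [hinner]
    have h3 : ∑ a : TorusSite d₁ L₁, ∑ i ∈ T, c i * ∑ b : TorusSite d₂ L₂, wv i b * ‖S (a, b)‖ ^ 2 =
        ∑ i ∈ T, c i * ∑ a : TorusSite d₁ L₁, ∑ b : TorusSite d₂ L₂, wv i b * ‖S (a, b)‖ ^ 2 := by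
      rw [sum_comm]
      refine sum_congr rfl fun i _ => ?_
      rw [mul_sum]
    rw [sum_add_distrib, sum_add_distrib, h3, ← mul_sum]
  rw [hsplit]
  have h0 := sum_sum_norm_sq_prodChar G
  have h1 := sum_sum_weight_fst_mul_norm_sq_le G u N
  have h2 := fun i => sum_sum_weight_snd_mul_norm_sq_le G (v i) N
  simp only [hS, hwu, hwv] at h0 h1 h2 ⊢
  rw [h0, mul_add, mul_add]
  refine add_le_add (add_le_add le_rfl ?_) ?_
  · rw [mul_left_comm]
    exact mul_le_mul_of_nonneg_left h1 hc₀
  · rw [mul_sum]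
    refine sum_le_sum fun i hi => ?_
    rw [mul_left_comm]
    exact mul_le_mul_of_nonneg_left (h2 i) (hc i hi)

end Literature.Probability.LatticeModels

end
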